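import Summits.Ventures.Crystal3D.Theorems.StickyWulffConstantPolycrystalWulffBoundRungSingleAxisOfTwoGrain

/-!
# `PolycrystalWulffBound`, line `PolyDensity`: the TWO-GRAIN TWIN INEQUALITY as lane P's NAMED FACT for
# the single-axis class, and the class BY NAME from it (crux `stmt-Ventures-19482` / `23911`;
# cf-p1 DECISION (xciv)(ii); memo P-THI-g17)

Route `StickyWulffConstant` of the venture `Summits/Ventures/Crystal3D`, second prover lane (poly-p2,
gen 17).  `TwoGrainTwinInequality` is hypothesis H2 of `rung_singleAxis_of_twoGrain` (p680663) made
standalone: for every crux frame `A` and every stacking axis `m₀` of `A '' Λ` (`Ax m₀ A A`), every pair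
of disjoint polyhedral finite-volume sets `S₁` (body `W A`) and `S₂` (body `(ℝ∙m₀)ᗮ.reflection '' W A`)
satisfies the crux bound with the twin-wall kernel `Dsc m₀` at charge `½`.
`singleAxisClass_of_twoGrainTwinInequality` derives the SINGLE-AXIS CLASS of the crux (all grains
pairwise co-axial about one axis; any number of grains, lamellae, twins, cycles) from it, by p680663.

CERTIFICATE FIELDS (why the fact is believed true — it is NOT proved in the kernel):
* PAPER PROOF: memo P-THI-g17 (poly-p2 g17, evidence on stmt-Ventures-19482, sha16 97cd4c906ad8ce10),
  §2–§6: (1) the 2D TWIN-HEXAGON INEQUALITY THI(P,Q;κ) for every κ ≥ δ = Q − P — SHARP — by a PAIRED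
  KNOTHE CALIBRATION on the six vertex sectors of `H(P,Q)` (semi-discrete split of the competitor into six
  equal-area cells of a PL convex function with gradients at 60°k; per-cell Knothe maps onto `H ∩ W_k` and
  `(−H) ∩ W_k`; `div ≥ 2√det` by AM–GM on the triangular Jacobian; every crease jump ≥ 0 by monotonicity of
  PL-convex cells; interface ≤ the sector pair's Knothe discrepancy = δ exactly: two translation regimes
  + the BAND LEMMA, whose real algebra is the kernel file `…PolycrystalWulffBoundKnotheBandLemma`);
  (2) the primal SLICING REDUCTION (P-TWIN-g16 §5, S1–S4): pointwise `h_W(ν) ≥ a ν_z + h_{H(a)}(ν_h)`, the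
  divergence theorem for `k(z)e₃` with the monotone height rearrangement `k`, slicing of reduced boundaries by
  heights (coarea factor `|ν_h|`), AM–GM; the slice functional is exactly THI's with `H = H(k(z))`, interface
  cost = the wall constant; (3) `δ(a) ≤ 1/√6 < ½` at every height, so the inequality holds for the wall law
  `c·|ν_h|` iff `c ≥ 1/√6` (necessity: `…TwinSupportGap`), in particular at the crux's `½` (margin 0.092).
* NUMERICAL LINEAGES of the sector discrepancy `= δ`: poly-p2 calc-g17 (exact piecewise-quadratic quantiles
  and a 500²-pixel Knothe sort) and cf-p2 PREREG §70 (independent code, six cases, sup = 1.000000·δ,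
  translation identities to 4e−11); of the composition-criterion numerics behind it: P-TWIN-g16 §11 and cf-p2 §68.
* EQUALITY CASES: `W`, its mirror image, and the coherent central twin `E₀` (`…CoherentTwinEquality`,
  kernel) — the fact is tight on a genuine two-phase texture.
WHAT THIS IS NOT: a kernel proof of the fact (2D/3D geometric measure theory: Knothe maps, Gauss–Green for
BV fields on polygons, slicing — no Mathlib path today); the crux is not claimed.
-/

noncomputable section

open scoped BigOperators InnerProductSpace ENNReal Pointwise
open MeasureTheory Filter Set

namespace Summit.Ventures.Crystal3D.Cruxes.PolycrystalWulffBound.PolyDensity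

/-- **Named fact (lane P, single-axis class): the two-grain twin inequality at charge `½`** — hypothesis
H2 of `rung_singleAxis_of_twoGrain`, standalone.  Paper proof: memo P-THI-g17 §2–§6 (paired Knothe
calibration ⇒ twin-hexagon inequality for `κ ≥ δ(a)`, `δ(a) ≤ 1/√6 < ½`; slicing reduction P-TWIN-g16 §5);
see the module docstring for the certificate fields.  Not proved in the kernel. -/
def TwoGrainTwinInequality : Prop :=
    let Λ : Set (EuclideanSpace ℝ (Fin 3)) := Literature.MathematicalPhysics.StatisticalMechanics.fccStacking 1 (Real.sqrt (2 / 3));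
    let Brl : (ℤ → ℤ) → Set (EuclideanSpace ℝ (Fin 3)) := Literature.MathematicalPhysics.StatisticalMechanics.barlowStacking 1 (Real.sqrt (2 / 3));
    let Ax : EuclideanSpace ℝ (Fin 3) → (EuclideanSpace ℝ (Fin 3) ≃ₗᵢ[ℝ] EuclideanSpace ℝ (Fin 3)) → (EuclideanSpace ℝ (Fin 3) ≃ₗᵢ[ℝ] EuclideanSpace ℝ (Fin 3)) → Prop := fun m A B => ∃ (L : EuclideanSpace ℝ (Fin 3) ≃ₗᵢ[ℝ] EuclideanSpace ℝ (Fin 3)) (s₁ s₂ : EuclideanSpace ℝ (Fin 3)) (σ σ' : ℤ → ℤ), Literature.MathematicalPhysics.StatisticalMechanics.IsHaggSeq σ ∧ Literature.MathematicalPhysics.StatisticalMechanics.IsHaggSeq σ' ∧ L (EuclideanSpace.single (2 : Fin 3) (1 : ℝ)) = m ∧ A '' Λ ⊆ (fun q => L q + s₁) '' Brl σ ∧ B '' Λ ⊆ (fun q => L q + s₂) '' Brl σ';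
    let Φ : EuclideanSpace ℝ (Fin 3) → ℝ := fun ν => Real.sqrt 2 / 4 * ∑ᶠ w ∈ {w ∈ Λ | ‖w‖ = 1}, |⟪w, ν⟫_ℝ|;
    let Per : Set (EuclideanSpace ℝ (Fin 3)) → Set (EuclideanSpace ℝ (Fin 3)) → ℝ := fun K S => (⨆ (ξ : EuclideanSpace ℝ (Fin 3) → EuclideanSpace ℝ (Fin 3)) (_ : ContDiff ℝ 1 ξ ∧ HasCompactSupport ξ ∧ ∀ z, ξ z ∈ K), ENNReal.ofReal (∫ z in S, Literature.MathematicalPhysics.StatisticalMechanics.fieldDivergence ξ z)).toReal;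
    let ι : Set (EuclideanSpace ℝ (Fin 3)) → Set (EuclideanSpace ℝ (Fin 3)) → Set (EuclideanSpace ℝ (Fin 3)) → ℝ := fun K S₁ S₂ => (Per K S₁ + Per K S₂ - Per K (S₁ ∪ S₂)) / 2;
    let W : (EuclideanSpace ℝ (Fin 3) ≃ₗᵢ[ℝ] EuclideanSpace ℝ (Fin 3)) → Set (EuclideanSpace ℝ (Fin 3)) := fun A => {y | ∀ ν : EuclideanSpace ℝ (Fin 3), ⟪y, ν⟫_ℝ ≤ Φ (A.symm ν)};
    let Dsc : EuclideanSpace ℝ (Fin 3) → Set (EuclideanSpace ℝ (Fin 3)) := fun m => {y | ‖y‖ ≤ 1 ∧ ⟪y, m⟫_ℝ = 0};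
    let Poly : Set (EuclideanSpace ℝ (Fin 3)) → Prop := fun S => ∃ (k : ℕ) (H : Fin k → Finset ((EuclideanSpace ℝ (Fin 3)) × ℝ)), S = ⋃ i, ⋂ p ∈ H i, {x | ⟪p.1, x⟫_ℝ < p.2};
    ∀ (A : EuclideanSpace ℝ (Fin 3) ≃ₗᵢ[ℝ] EuclideanSpace ℝ (Fin 3)) (m₀ : EuclideanSpace ℝ (Fin 3)), Ax m₀ A A →
      ∀ S₁ S₂ : Set (EuclideanSpace ℝ (Fin 3)), Poly S₁ → Poly S₂ → volume S₁ < ⊤ → volume S₂ < ⊤ → Disjoint S₁ S₂ →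
        6 * (2 : ℝ) ^ ((1 : ℝ) / 3) * (Real.sqrt 2 * (volume (S₁ ∪ S₂)).toReal) ^ ((2 : ℝ) / 3) ≤
          (Per (W A) S₁ - ι (W A) S₁ S₂) +
          (Per ((ℝ ∙ m₀)ᗮ.reflection '' W A) S₂ - ι ((ℝ ∙ m₀)ᗮ.reflection '' W A) S₂ S₁) +
          1 / 2 * ι (Dsc m₀) S₁ S₂

/-- **The single-axis class of `PolycrystalWulffBound` BY NAME from the named fact**: for a crux texture
with polyhedral grains whose frames are pairwise co-axial about one axis `m₀`, the crux energy bound holds,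
given `TwoGrainTwinInequality` (one call of `rung_singleAxis_of_twoGrain`, p680663). -/
theorem singleAxisClass_of_twoGrainTwinInequality (hTG : TwoGrainTwinInequality) :
    let Λ : Set (EuclideanSpace ℝ (Fin 3)) := Literature.MathematicalPhysics.StatisticalMechanics.fccStacking 1 (Real.sqrt (2 / 3));
    let Brl : (ℤ → ℤ) → Set (EuclideanSpace ℝ (Fin 3)) := Literature.MathematicalPhysics.StatisticalMechanics.barlowStacking 1 (Real.sqrt (2 / 3));
    let Ax : EuclideanSpace ℝ (Fin 3) → (EuclideanSpace ℝ (Fin 3) ≃ₗᵢ[ℝ] EuclideanSpace ℝ (Fin 3)) → (EuclideanSpace ℝ (Fin 3) ≃ₗᵢ[ℝ] EuclideanSpace ℝ (Fin 3)) → Prop := fun m A B => ∃ (L : EuclideanSpace ℝ (Fin 3) ≃ₗᵢ[ℝ] EuclideanSpace ℝ (Fin 3)) (s₁ s₂ : EuclideanSpace ℝ (Fin 3)) (σ σ' : ℤ → ℤ), Literature.MathematicalPhysics.StatisticalMechanics.IsHaggSeq σ ∧ Literature.MathematicalPhysics.StatisticalMechanics.IsHaggSeq σ' ∧ L (EuclideanSpace.single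 (2 : Fin 3) (1 : ℝ)) = m ∧ A '' Λ ⊆ (fun q => L q + s₁) '' Brl σ ∧ B '' Λ ⊆ (fun q => L q + s₂) '' Brl σ';
    let CoAx : (EuclideanSpace ℝ (Fin 3) ≃ₗᵢ[ℝ] EuclideanSpace ℝ (Fin 3)) → (EuclideanSpace ℝ (Fin 3) ≃ₗᵢ[ℝ] EuclideanSpace ℝ (Fin 3)) → Prop := fun A B => ∃ m, Ax m A B;
    let Φ : EuclideanSpace ℝ (Fin 3) → ℝ := fun ν => Real.sqrt 2 / 4 * ∑ᶠ w ∈ {w ∈ Λ | ‖w‖ = 1}, |⟪w, ν⟫_ℝ|;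
    let Per : Set (EuclideanSpace ℝ (Fin 3)) → Set (EuclideanSpace ℝ (Fin 3)) → ℝ := fun K S => (⨆ (ξ : EuclideanSpace ℝ (Fin 3) → EuclideanSpace ℝ (Fin 3)) (_ : ContDiff ℝ 1 ξ ∧ HasCompactSupport ξ ∧ ∀ z, ξ z ∈ K), ENNReal.ofReal (∫ z in S, Literature.MathematicalPhysics.StatisticalMechanics.fieldDivergence ξ z)).toReal;
    let ι : Set (EuclideanSpace ℝ (Fin 3)) → Set (EuclideanSpace ℝ (Fin 3)) → Set (EuclideanSpace ℝ (Fin 3)) → ℝ := fun K S₁ S₂ => (Per K S₁ + Per K S₂ - Per K (S₁ ∪ S₂)) / 2;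
    let W : (EuclideanSpace ℝ (Fin 3) ≃ₗᵢ[ℝ] EuclideanSpace ℝ (Fin 3)) → Set (EuclideanSpace ℝ (Fin 3)) := fun A => {y | ∀ ν : EuclideanSpace ℝ (Fin 3), ⟪y, ν⟫_ℝ ≤ Φ (A.symm ν)};
    let Dsc : EuclideanSpace ℝ (Fin 3) → Set (EuclideanSpace ℝ (Fin 3)) := fun m => {y | ‖y‖ ≤ 1 ∧ ⟪y, m⟫_ℝ = 0};
    let Tex : (n : ℕ) → (Fin n → Set (EuclideanSpace ℝ (Fin 3))) → (Fin n → (EuclideanSpace ℝ (Fin 3) ≃ₗᵢ[ℝ] EuclideanSpace ℝ (Fin 3))) → (Fin n → Fin n → ℝ) → (Fin n → Fin n → EuclideanSpace ℝ (Fin 3)) → Prop := fun n G A c m => (∀ f : Fin n, Literature.MathematicalPhysics.StatisticalMechanics.HasFinitePerimeter (G f) ∧ volume (G f) < ⊤) ∧ (∀ f g, f ≠ g → Disjoint (G f) (G g)) ∧ (∀ f g, f ≠ g → 0 ≤ c f g) ∧ (∀ f g, f ≠ g → ¬ CoAx (A f) (A g) → m f g = 0 ∧ 1 ≤ c f g)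 ∧ (∀ f g, f ≠ g → CoAx (A f) (A g) → A f '' Λ ≠ A g '' Λ → Ax (m f g) (A f) (A g) ∧ 1 / 2 ≤ c f g);
    let En : (n : ℕ) → (Fin n → Set (EuclideanSpace ℝ (Fin 3))) → (Fin n → (EuclideanSpace ℝ (Fin 3) ≃ₗᵢ[ℝ] EuclideanSpace ℝ (Fin 3))) → (Fin n → Fin n → ℝ) → (Fin n → Fin n → EuclideanSpace ℝ (Fin 3)) → ℝ := fun n G A c m => ∑ f : Fin n, Per (W (A f)) (G f) - ∑ f, ∑ g, (if f = g then 0 else ι (W (A f)) (G f) (G g)) + ∑ f, ∑ g, (if f = g then 0 else c f g / 2 * ι (Dsc (m f g)) (G f) (G g));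
    let Vol : (n : ℕ) → (Fin n → Set (EuclideanSpace ℝ (Fin 3))) → ℝ := fun n G => (volume (⋃ f : Fin n, G f)).toReal;
    let Poly : Set (EuclideanSpace ℝ (Fin 3)) → Prop := fun S => ∃ (k : ℕ) (H : Fin k → Finset ((EuclideanSpace ℝ (Fin 3)) × ℝ)), S = ⋃ i, ⋂ p ∈ H i, {x | ⟪p.1, x⟫_ℝ < p.2};
    ∀ (n : ℕ) (G : Fin n → Set (EuclideanSpace ℝ (Fin 3)))
      (A : Fin n → (EuclideanSpace ℝ (Fin 3) ≃ₗᵢ[ℝ] EuclideanSpace ℝ (Fin 3)))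
      (c : Fin n → Fin n → ℝ) (mm : Fin n → Fin n → EuclideanSpace ℝ (Fin 3)) (m₀ : EuclideanSpace ℝ (Fin 3)),
      Tex n G A c mm → (∀ f, Poly (G f)) → (∀ f g, Ax m₀ (A f) (A g)) →
      6 * (2 : ℝ) ^ ((1 : ℝ) / 3) * (Real.sqrt 2 * Vol n G) ^ ((2 : ℝ) / 3) ≤ En n G A c mm := by
  intro Λ Brl Ax CoAx Φ Per ι W Dsc Tex En Vol Poly n G A c mm m₀ hTex hPoly hAx
  exact rung_singleAxis_of_twoGrain n G A c mm m₀ hTex hPoly hAx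
    (fun f₀ S₁ S₂ hP₁ hP₂ hv₁ hv₂ hd => hTG (A f₀) m₀ (hAx f₀ f₀) S₁ S₂ hP₁ hP₂ hv₁ hv₂ hd)

end Summit.Ventures.Crystal3D.Cruxes.PolycrystalWulffBound.PolyDensity

end
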